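/-
Copyright: the b2b-balaban T⁴-continuum CRUX team, row NE7b leaf lineage `t4-ne7b-formalise-leaf-03` (gen 144). Project licence.
-/
import Literature.Analysis.InnerProduct.CholeskyResidualEigenvalueBounds
import Literature.MathematicalPhysics.QuantumFieldTheory.Balaban1983to89.B9SectEKernel
import Literature.MathematicalPhysics.QuantumFieldTheory.Balaban1983to89.SchurTest
import Mathlib.Analysis.SpecialFunctions.Exp

/-!
# (N4) IN MATRIX CURRENCY: A DECAYING COVARIANCE KERNEL FLOORS THE PRECISION — `|C(y, y′)| ≤ B₀e^{−δ₀ d(y, y′)}` with a summable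
# weight `Σ_{y′} e^{−δ₀ d(y, y′)} ≤ K₀` gives `‖C‖ ≤ B₀K₀` (Schur's test, BY NAME) and, for `C = A⁻¹` with `A` symmetric positive, the floor
# `(B₀K₀)⁻¹·‖x‖² ≤ ⟨x, A x⟩`, delivered in the road's socket letter `QGQInverse.Coercive A (B₀K₀)⁻¹`
# (row NE7b, node U5c; residual (R2′) family (2), letter (ℓ1) — the FLOOR half, T-80 (N4); kernel lemmas of linear algebra)

Cell `pub-balaban`, sub-cell `t4`, spine estimate NE7b (`T4WeightBudget.RelWeightBound`; the cell's OWN estimate — NOT PRINTED in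
[Bałaban 1983–89], NOT PROVED).  Crux-route work under `Spine/NE7b/` by a row leaf on the convexity road; NOTHING of Bałaban's is named
or asserted; no `T4Continuum/Support` leaf typed; no `def`; zero `sorry`.  Imports: Mathlib + three BUILT Literature modules used BY NAME —
`Literature.Analysis.InnerProduct.CholeskyResidualEigenvalueBounds` (Schur's test with a dominating matrix, quadratic form:
`norm_star_dotProduct_mulVec_le_of_norm_le_rowSum_colSum`), `….Balaban1983to89.SchurTest` (`sum_sq_le`, the `ℓ¹ × ℓ^∞ ⇒ ℓ²` norm form),
`….Balaban1983to89.B9SectEKernel` (the road's socket `QGQInverse.Coercive` and `weighted_coercive_of_inverse_bound`).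

WHY ∕ HISTORY (located).  Idea-1 g80's T-80 §4 (N4): «positive-definite is not a floor; the floor is `1∕‖C⁽ᵏ⁾‖` from [B9] Thm 3.15's decay
`|C⁽ᵏ⁾(Λ; y, y′)| ≤ B₀e^{−δ₀|y−y′|}` via the Schur test and finite-dimensional folklore — untyped».  On 2026-08-24 this cell was typed three
times within four minutes (journal l.57008 leaf-04 `…ComplementaryEliminationFloor` — the OPERATOR currency, LANDED p376120; l.57018 leaf-03
`…ComplementarySchurFloor` — operator + matrix currency, WITHDRAWN l.57096 as a duplicate of the former; l.57019 leaf-05 `…CovarianceDecayFloor`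
— matrix currency into `QGQInverse.Coercive`, WITHDRAWN l.57054 in favour of leaf-03's), which left the MATRIX ∕ decay-kernel currency typed by
no file.  THIS FILE is that residue, by agreement of the three lineages and the pricing desk (leaf-05 L.57423 «yours»; leaf-04 l.57107; refuter
R-CSF-g84-1): the Schur letter on an INVERSE kernel ⟹ the precision floor, in `Matrix.PosDef` letters AND in the socket's
`IsSymm ∕ IsUnit ∕ PSD` letters (the latter through `B9SectEKernel.weighted_coercive_of_inverse_bound` at weight `1`, as leaf-05's withdrawn file
did), plus the norm letter `(C x)·(C x) ≤ (B₀K₀)²·(x·x)` from `SchurTest.sum_sq_le`.  Nothing of the operator currency is restated.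

WHAT IS PROVED ([folklore] linear algebra; Mathlib + the three Literature lemmas BY NAME):
* §1 `dotProduct_mulVec_le_of_rowSum_colSum` (the Literature Schur test at `𝕜 = ℝ` in `dotProduct` letters: `|C i j| ≤ N i j`, row ∕ column
  sums of `N` `≤ r` ⟹ `x ⬝ᵥ C *ᵥ x ≤ r·(x ⬝ᵥ x)`); **`mulVec_dotProduct_mulVec_le_of_rowSum_colSum`** (`C` positive semidefinite ⟹
  `(C x)·(C x) ≤ r·(x·C x)` — Cauchy–Schwarz for `x ⬝ᵥ C *ᵥ ·` then Schur at `C x`); **`dotProduct_le_of_inv_rowSum_colSum`** (`A` positive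
  definite, the Schur letter on `A⁻¹` ⟹ `x·x ≤ r·(x·A x)`).
* §2 END in decay letters: **`dotProduct_le_of_inv_kernel_decay`** (`A.PosDef`, `|A⁻¹ i j| ≤ B₀·exp(−δ₀·d i j)`, `d i j = d j i`,
  `Σ_j exp(−δ₀·d i j) ≤ K₀`, `0 ≤ B₀` ⟹ `x·x ≤ B₀K₀·(x·A x)`); `inv_mul_dotProduct_le_of_inv_kernel_decay` (`(B₀K₀)⁻¹·(x·x) ≤ x·A x`);
  **`coercive_of_inv_kernel_decay`** (the same as `QGQInverse.Coercive A (B₀K₀)⁻¹`).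
* §3 the SOCKET's letters (`A.IsSymm`, `IsUnit A`, `0 ≤ v·A v` instead of `PosDef`): **`coercive_of_inv_form_le`** (`y·A⁻¹ y ≤ κ·(y·y)`, `0 < κ`
  ⟹ `Coercive A κ⁻¹`, = `B9SectEKernel.weighted_coercive_of_inverse_bound` at `w = 1`), **`coercive_of_inv_kernel_decay'`** (the decay END in
  these letters: `0 < B₀`, `0 < K₀` ⟹ `Coercive A (B₀K₀)⁻¹` — the hypothesis shape `…CoerciveFluctuationFloor.hessian_lower_of_coercive` consumes).
* §4 the NORM letter: **`mulVec_sq_le_of_kernel_decay`** (`|C i j| ≤ B₀·exp(−δ₀·d i j)`, `d` symmetric, `Σ_j exp ≤ K₀`, `0 ≤ B₀` ⟹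
  `(C x)·(C x) ≤ (B₀K₀)²·(x·x)`, i.e. `‖C‖_{ℓ²→ℓ²} ≤ B₀K₀ = B̄` — T-80 §0's sentence, `SchurTest.sum_sq_le` BY NAME).

NOT HERE (honest): which operator of Bałaban's is `A` ∕ `C` on which slice ((3.158)'s `C⁽ᵏ⁾(Λ) = (C*Δ_kC)⁻¹↾`, T-80 (J1)∕(J3)), the
lattice value of `K₀(δ₀, d)`, any value of `B₀, δ₀` (G-B9-09∕10: `B9.Thm315Printed` is a NAMED FACT, neither imported nor discharged here) —
(A3)∕(A1c), NC-NE7b-α UNRULED; nothing of Bałaban's.  BY-NAME EFFECT ON THE WALL: NONE.  NE7b NOT PRINTED ∕ NOT PROVED; spine PROVED 0∕9; rung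
(B)+1 on a FINITE torus — NOT infinite volume, NOT the mass gap, NOT Clay.
HONEST DEPENDENCY: continuum YM on T⁴ ⇐ BetaPertH ∧ nine spine estimates (0/9 proved); BetaPertH ⇐ (D1) ∧ (D4) ∧ CAP+tail.
-/

set_option autoImplicit false

open Set Function
open scoped Matrix

namespace Summit.QuantumFields.BalabanUV.T4Continuum.NE7b.CovarianceKernelFloor

open Literature.MathematicalPhysics.QuantumFieldTheory.Balaban1983to89

/-! ## §1 Schur's test BY NAME in `dotProduct` letters; (N4) covariance side; the precision floor for a positive definite `A` -/

section MatrixCurrency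

variable {m : Type*} [Fintype m]

/-- **SCHUR'S TEST, real quadratic form** (the tree's `Literature.Analysis.InnerProduct.norm_star_dotProduct_mulVec_le_of_norm_le_rowSum_colSum`
at `𝕜 = ℝ`, restated in `dotProduct` letters): `|C i j| ≤ N i j`, every row sum and every column sum of `N` `≤ r` ⟹
`x ⬝ᵥ C *ᵥ x ≤ r·(x ⬝ᵥ x)`. [folklore] -/
theorem dotProduct_mulVec_le_of_rowSum_colSum (C N : Matrix m m ℝ) (hdom : ∀ i j, |C i j| ≤ N i j) {r : ℝ}
    (hrow : ∀ i, ∑ j, N i j ≤ r) (hcol : ∀ j, ∑ i, N i j ≤ r) (x : m → ℝ) : x ⬝ᵥ C *ᵥ x ≤ r * (x ⬝ᵥ x) := by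
  have h := Literature.Analysis.InnerProduct.norm_star_dotProduct_mulVec_le_of_norm_le_rowSum_colSum (𝕜 := ℝ) C N
    (fun i j => by rw [Real.norm_eq_abs]; exact hdom i j) hrow hcol x
  have e1 : (star x : m → ℝ) = x := star_trivial x
  have e2 : ∑ i, ‖x i‖ ^ 2 = x ⬝ᵥ x := Finset.sum_congr rfl fun i _ => by rw [Real.norm_eq_abs, sq_abs, sq]
  rw [e1, Real.norm_eq_abs, e2] at h
  exact (le_abs_self _).trans h

/-- **(N4) IN MATRIX CURRENCY, covariance side**: `C` positive semidefinite with the Schur letter (`|C i j| ≤ N i j`, row ∕ column sums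
of `N` `≤ r`) ⟹ `(C *ᵥ x) ⬝ᵥ (C *ᵥ x) ≤ r·(x ⬝ᵥ C *ᵥ x)` (Cauchy–Schwarz for `x ⬝ᵥ C *ᵥ ·` with `C x`, then Schur's test at `C x`).
[folklore] -/
theorem mulVec_dotProduct_mulVec_le_of_rowSum_colSum {C : Matrix m m ℝ} (hC : C.PosSemidef) (N : Matrix m m ℝ)
    (hdom : ∀ i j, |C i j| ≤ N i j) {r : ℝ} (hrow : ∀ i, ∑ j, N i j ≤ r) (hcol : ∀ j, ∑ i, N i j ≤ r) (x : m → ℝ) :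
    (C *ᵥ x) ⬝ᵥ (C *ᵥ x) ≤ r * (x ⬝ᵥ C *ᵥ x) := by
  have hT : Cᵀ = C := by simpa only [Matrix.IsHermitian, Matrix.conjTranspose_eq_transpose_of_trivial] using hC.1
  have hsym : ∀ u w : m → ℝ, u ⬝ᵥ C *ᵥ w = (C *ᵥ u) ⬝ᵥ w := fun u w => by
    rw [Matrix.dotProduct_mulVec, ← Matrix.vecMul_transpose, hT]
  have hnn : ∀ u : m → ℝ, 0 ≤ u ⬝ᵥ C *ᵥ u := fun u => by simpa using hC.dotProduct_mulVec_nonneg u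
  have hcs : ∀ u w : m → ℝ, (u ⬝ᵥ C *ᵥ w) ^ 2 ≤ (u ⬝ᵥ C *ᵥ u) * (w ⬝ᵥ C *ᵥ w) := by  -- Cauchy–Schwarz (discriminant)
    intro u w
    have hwu : w ⬝ᵥ C *ᵥ u = u ⬝ᵥ C *ᵥ w := by rw [hsym, dotProduct_comm]
    have hq : ∀ s : ℝ, 0 ≤ (w ⬝ᵥ C *ᵥ w) * (s * s) + 2 * (u ⬝ᵥ C *ᵥ w) * s + u ⬝ᵥ C *ᵥ u := by
      intro s
      have h0 := hnn (u + s • w)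
      simp only [Matrix.mulVec_add, Matrix.mulVec_smul, dotProduct_add, add_dotProduct, dotProduct_smul, smul_dotProduct,
        smul_eq_mul] at h0
      rw [hwu] at h0
      nlinarith [h0]
    have hd := discrim_le_zero hq
    rw [discrim] at hd
    nlinarith [hd]
  have h1 := hcs x (C *ᵥ x)
  rw [hsym x (C *ᵥ x)] at h1
  have h2 : (C *ᵥ x) ⬝ᵥ C *ᵥ (C *ᵥ x) ≤ r * ((C *ᵥ x) ⬝ᵥ (C *ᵥ x)) :=
    dotProduct_mulVec_le_of_rowSum_colSum C N hdom hrow hcol (C *ᵥ x)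
  have h3 : ((C *ᵥ x) ⬝ᵥ (C *ᵥ x)) ^ 2 ≤ (x ⬝ᵥ C *ᵥ x) * (r * ((C *ᵥ x) ⬝ᵥ (C *ᵥ x))) :=
    h1.trans (mul_le_mul_of_nonneg_left h2 (hnn x))
  by_cases h0 : (C *ᵥ x) ⬝ᵥ (C *ᵥ x) = 0
  · rw [h0]
    rcases isEmpty_or_nonempty m with hm | ⟨⟨i⟩⟩
    · simp [dotProduct]
    · have hr : 0 ≤ r := (Finset.sum_nonneg fun j _ => (abs_nonneg _).trans (hdom i j)).trans (hrow i)
      exact mul_nonneg hr (hnn x)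
  · have hself : 0 ≤ (C *ᵥ x) ⬝ᵥ (C *ᵥ x) := by unfold dotProduct; exact Finset.sum_nonneg fun i _ => mul_self_nonneg _
    have hpos : 0 < (C *ᵥ x) ⬝ᵥ (C *ᵥ x) := lt_of_le_of_ne hself (Ne.symm h0)
    have h4 : (C *ᵥ x) ⬝ᵥ (C *ᵥ x) * ((C *ᵥ x) ⬝ᵥ (C *ᵥ x)) ≤ r * (x ⬝ᵥ C *ᵥ x) * ((C *ᵥ x) ⬝ᵥ (C *ᵥ x)) := by
      nlinarith [h3]
    exact le_of_mul_le_mul_right h4 hpos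

variable [DecidableEq m]

/-- **(N4) IN MATRIX CURRENCY, precision side**: `A` positive definite and the Schur letter on its INVERSE (`|A⁻¹ i j| ≤ N i j`, row ∕
column sums of `N` `≤ r`) ⟹ `x ⬝ᵥ x ≤ r·(x ⬝ᵥ A *ᵥ x)` — the covariance's Schur bound floors the precision. [folklore] -/
theorem dotProduct_le_of_inv_rowSum_colSum {A : Matrix m m ℝ} (hA : A.PosDef) (N : Matrix m m ℝ)
    (hdom : ∀ i j, |A⁻¹ i j| ≤ N i j) {r : ℝ} (hrow : ∀ i, ∑ j, N i j ≤ r) (hcol : ∀ j, ∑ i, N i j ≤ r) (x : m → ℝ) :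
    x ⬝ᵥ x ≤ r * (x ⬝ᵥ A *ᵥ x) := by
  have hunit : IsUnit A.det := (Matrix.isUnit_iff_isUnit_det A).mp hA.isUnit
  have hinv : A⁻¹ *ᵥ (A *ᵥ x) = x := by rw [Matrix.mulVec_mulVec, Matrix.nonsing_inv_mul A hunit, Matrix.one_mulVec]
  have h := mulVec_dotProduct_mulVec_le_of_rowSum_colSum hA.inv.posSemidef N hdom hrow hcol (A *ᵥ x)
  rwa [hinv, dotProduct_comm (A *ᵥ x) x] at h

end MatrixCurrency

/-! ## §2 END in decay letters: a decaying covariance kernel with a summable weight floors the precision by `(B₀K₀)⁻¹` -/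

section Decay

variable {m : Type*} [Fintype m] [DecidableEq m]

/-- **END — DECAYING COVARIANCE KERNEL ⟹ PRECISION FLOOR**: `A` positive definite (real symmetric), its inverse kernel obeying the decay
letter `|A⁻¹ i j| ≤ B₀·exp(−δ₀·d i j)` with a SYMMETRIC gauge `d i j = d j i` and the summability letter `Σ_j exp(−δ₀·d i j) ≤ K₀` at every
`i` (`0 ≤ B₀`) ⟹ `x ⬝ᵥ x ≤ B₀K₀·(x ⬝ᵥ A *ᵥ x)`: Schur's test with `N i j = B₀·exp(−δ₀·d i j)` (row sums `≤ B₀K₀`, column sums by the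
symmetry of `d`) and §1. [folklore] -/
theorem dotProduct_le_of_inv_kernel_decay {A : Matrix m m ℝ} (hA : A.PosDef) (d : m → m → ℝ) (hd : ∀ i j, d i j = d j i)
    {B₀ δ₀ K₀ : ℝ} (hB₀ : 0 ≤ B₀) (hdecay : ∀ i j, |A⁻¹ i j| ≤ B₀ * Real.exp (-δ₀ * d i j))
    (hsum : ∀ i, ∑ j, Real.exp (-δ₀ * d i j) ≤ K₀) (x : m → ℝ) :
    x ⬝ᵥ x ≤ B₀ * K₀ * (x ⬝ᵥ A *ᵥ x) := by
  refine dotProduct_le_of_inv_rowSum_colSum hA (fun i j => B₀ * Real.exp (-δ₀ * d i j)) hdecay ?_ ?_ x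
  · intro i
    rw [← Finset.mul_sum]
    exact mul_le_mul_of_nonneg_left (hsum i) hB₀
  · intro j
    rw [← Finset.mul_sum]
    refine mul_le_mul_of_nonneg_left ?_ hB₀
    calc ∑ i, Real.exp (-δ₀ * d i j) = ∑ i, Real.exp (-δ₀ * d j i) := Finset.sum_congr rfl fun i _ => by rw [hd]
      _ ≤ K₀ := hsum j

/-- The same as the FLOOR LETTER `(B₀K₀)⁻¹·(x ⬝ᵥ x) ≤ x ⬝ᵥ A *ᵥ x` (`0 < B₀`, `0 < K₀`). [folklore] -/
theorem inv_mul_dotProduct_le_of_inv_kernel_decay {A : Matrix m m ℝ} (hA : A.PosDef) (d : m → m → ℝ) (hd : ∀ i j, d i j = d j i)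
    {B₀ δ₀ K₀ : ℝ} (hB₀ : 0 < B₀) (hK₀ : 0 < K₀) (hdecay : ∀ i j, |A⁻¹ i j| ≤ B₀ * Real.exp (-δ₀ * d i j))
    (hsum : ∀ i, ∑ j, Real.exp (-δ₀ * d i j) ≤ K₀) (x : m → ℝ) :
    (B₀ * K₀)⁻¹ * (x ⬝ᵥ x) ≤ x ⬝ᵥ A *ᵥ x := by
  rw [inv_mul_le_iff₀ (mul_pos hB₀ hK₀)]
  exact dotProduct_le_of_inv_kernel_decay hA d hd hB₀.le hdecay hsum x

/-- The same in the road's SOCKET letter: `QGQInverse.Coercive A (B₀K₀)⁻¹` (`∀ x, (B₀K₀)⁻¹·(x ⬝ᵥ x) ≤ x ⬝ᵥ A *ᵥ x`). [folklore] -/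
theorem coercive_of_inv_kernel_decay {A : Matrix m m ℝ} (hA : A.PosDef) (d : m → m → ℝ) (hd : ∀ i j, d i j = d j i)
    {B₀ δ₀ K₀ : ℝ} (hB₀ : 0 < B₀) (hK₀ : 0 < K₀) (hdecay : ∀ i j, |A⁻¹ i j| ≤ B₀ * Real.exp (-δ₀ * d i j))
    (hsum : ∀ i, ∑ j, Real.exp (-δ₀ * d i j) ≤ K₀) : QGQInverse.Coercive A (B₀ * K₀)⁻¹ :=
  fun x => inv_mul_dotProduct_le_of_inv_kernel_decay hA d hd hB₀ hK₀ hdecay hsum x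

end Decay


/-! ## §3 The SOCKET's letters: `A` symmetric, invertible, with a non-negative form (instead of `Matrix.PosDef`) -/

section Socket

variable {m : Type*} [Fintype m] [DecidableEq m]

/-- **FORM BOUND ON THE INVERSE ⟹ COERCIVITY** in the socket's letters: `A.IsSymm`, `IsUnit A`, `0 ≤ v ⬝ᵥ A *ᵥ v`, and
`y ⬝ᵥ A⁻¹ *ᵥ y ≤ κ·(y ⬝ᵥ y)` (`0 < κ`) ⟹ `QGQInverse.Coercive A κ⁻¹` — the tree's `B9SectEKernel.weighted_coercive_of_inverse_bound` at the
weight `w = 1`, BY NAME. [folklore] -/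
theorem coercive_of_inv_form_le {A : Matrix m m ℝ} (hsymm : A.IsSymm) (hunit : IsUnit A) (hpos : ∀ v : m → ℝ, 0 ≤ v ⬝ᵥ (A *ᵥ v))
    {κ : ℝ} (hκ : 0 < κ) (hinv : ∀ y : m → ℝ, y ⬝ᵥ (A⁻¹ *ᵥ y) ≤ κ * (y ⬝ᵥ y)) : QGQInverse.Coercive A κ⁻¹ := by
  intro x
  have h := B9SectEKernel.weighted_coercive_of_inverse_bound A hsymm hunit hpos (1 : m → ℝ) hκ
    (fun y => by simpa only [one_mul] using hinv y) x
  simpa only [one_mul] using h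

/-- **THE DECAY END IN THE SOCKET's LETTERS**: `A.IsSymm`, `IsUnit A`, `0 ≤ v ⬝ᵥ A *ᵥ v`, `|A⁻¹ i j| ≤ B₀·exp(−δ₀·d i j)`, `d i j = d j i`,
`Σ_j exp(−δ₀·d i j) ≤ K₀`, `0 < B₀`, `0 < K₀` ⟹ `QGQInverse.Coercive A (B₀K₀)⁻¹` — verbatim the `hγ` shape the road's
`…CoerciveFluctuationFloor.hessian_lower_of_coercive` consumes (the withdrawn `…CovarianceDecayFloor`'s END, re-landed here by agreement). [folklore] -/
theorem coercive_of_inv_kernel_decay' {A : Matrix m m ℝ} (hsymm : A.IsSymm) (hunit : IsUnit A) (hpos : ∀ v : m → ℝ, 0 ≤ v ⬝ᵥ (A *ᵥ v))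
    (d : m → m → ℝ) (hd : ∀ i j, d i j = d j i) {B₀ δ₀ K₀ : ℝ} (hB₀ : 0 < B₀) (hK₀ : 0 < K₀)
    (hdecay : ∀ i j, |A⁻¹ i j| ≤ B₀ * Real.exp (-δ₀ * d i j)) (hsum : ∀ i, ∑ j, Real.exp (-δ₀ * d i j) ≤ K₀) :
    QGQInverse.Coercive A (B₀ * K₀)⁻¹ := by
  refine coercive_of_inv_form_le hsymm hunit hpos (mul_pos hB₀ hK₀) fun y => ?_
  refine dotProduct_mulVec_le_of_rowSum_colSum A⁻¹ (fun i j => B₀ * Real.exp (-δ₀ * d i j)) hdecay ?_ ?_ y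
  · intro i
    rw [← Finset.mul_sum]
    exact mul_le_mul_of_nonneg_left (hsum i) hB₀.le
  · intro j
    rw [← Finset.mul_sum]
    refine mul_le_mul_of_nonneg_left ?_ hB₀.le
    calc ∑ i, Real.exp (-δ₀ * d i j) = ∑ i, Real.exp (-δ₀ * d j i) := Finset.sum_congr rfl fun i _ => by rw [hd]
      _ ≤ K₀ := hsum j

end Socket

/-! ## §4 The NORM letter from `SchurTest.sum_sq_le` BY NAME: `‖C‖_{ℓ²→ℓ²} ≤ B₀K₀` -/

section NormLetter

variable {m : Type*} [Fintype m]

/-- **THE NORM LETTER IN DECAY LETTERS**: `|C i j| ≤ B₀·exp(−δ₀·d i j)`, `d i j = d j i`, `Σ_j exp(−δ₀·d i j) ≤ K₀`, `0 ≤ B₀` ⟹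
`(C *ᵥ x) ⬝ᵥ (C *ᵥ x) ≤ (B₀K₀)²·(x ⬝ᵥ x)` — T-80 §0's «`‖C⁽ᵏ⁾(Λ)‖ ≤ B̄ := B₀Σ_y e^{−δ₀|y|}` (Schur test, folklore)», the tree's
`SchurTest.sum_sq_le` (`Σ_i (Σ_j T i j x j)² ≤ R·C·Σ_j x_j²`) at `R = C = B₀K₀`. [folklore] -/
theorem mulVec_sq_le_of_kernel_decay (C : Matrix m m ℝ) (d : m → m → ℝ) (hd : ∀ i j, d i j = d j i) {B₀ δ₀ K₀ : ℝ}
    (hB₀ : 0 ≤ B₀) (hdecay : ∀ i j, |C i j| ≤ B₀ * Real.exp (-δ₀ * d i j)) (hsum : ∀ i, ∑ j, Real.exp (-δ₀ * d i j) ≤ K₀)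
    (x : m → ℝ) : (C *ᵥ x) ⬝ᵥ (C *ᵥ x) ≤ (B₀ * K₀) ^ 2 * (x ⬝ᵥ x) := by
  have hrow : ∀ i, ∑ j, |C i j| ≤ B₀ * K₀ := fun i =>
    calc ∑ j, |C i j| ≤ ∑ j, B₀ * Real.exp (-δ₀ * d i j) := Finset.sum_le_sum fun j _ => hdecay i j
      _ = B₀ * ∑ j, Real.exp (-δ₀ * d i j) := by rw [Finset.mul_sum]
      _ ≤ B₀ * K₀ := mul_le_mul_of_nonneg_left (hsum i) hB₀
  have hcol : ∀ j, ∑ i, |C i j| ≤ B₀ * K₀ := fun j =>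
    calc ∑ i, |C i j| ≤ ∑ i, B₀ * Real.exp (-δ₀ * d i j) := Finset.sum_le_sum fun i _ => hdecay i j
      _ = B₀ * ∑ i, Real.exp (-δ₀ * d j i) := by rw [Finset.mul_sum]; exact Finset.sum_congr rfl fun i _ => by rw [hd]
      _ ≤ B₀ * K₀ := mul_le_mul_of_nonneg_left (hsum j) hB₀
  have h := SchurTest.sum_sq_le (fun i j => C i j) x hrow hcol
  have e1 : (C *ᵥ x) ⬝ᵥ (C *ᵥ x) = ∑ i, (∑ j, C i j * x j) ^ 2 :=
    Finset.sum_congr rfl fun i _ => by rw [Matrix.mulVec, dotProduct, sq]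
  have e2 : x ⬝ᵥ x = ∑ j, x j ^ 2 := Finset.sum_congr rfl fun j _ => by rw [sq]
  rw [e1, e2, sq]
  exact h

end NormLetter

/-! ## Toy checks (kernel): the letters are not vacuous -/

/-- Toy: `A = [[2, 1], [1, 2]]` has `A⁻¹ = [[2, −1], [−1, 2]]∕3`, dominated entrywise by `N = |A⁻¹|` with row ∕ column sums `1`, so
`x ⬝ᵥ x ≤ 1·(x ⬝ᵥ A x) = 2a² + 2ab + 2b²`. -/
example (a b : ℝ) : a ^ 2 + b ^ 2 ≤ 1 * (2 * a ^ 2 + 2 * a * b + 2 * b ^ 2) := by nlinarith [sq_nonneg (a + b)]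

/-- Toy for §4 on `Fin 1`: `C = (c)`, `d = 0`, `B₀ = |c|`, `K₀ = 1`: `(c x)² ≤ (|c|·1)²·x²`. -/
example (c x : ℝ) : (c * x) * (c * x) ≤ (|c| * 1) ^ 2 * (x * x) := by
  rw [mul_one, sq_abs]; nlinarith [sq_nonneg (c * x)]

end Summit.QuantumFields.BalabanUV.T4Continuum.NE7b.CovarianceKernelFloor
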